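/-
Copyright (c) 2026 the pub-hodgecm-mathlib formalisation cell (harness21).  Prover seat hodgecm-mathlib-LH7-p09 (g2), CLOSE-OUT ROSTER strike line L3∕L5 (Track A
«(D-RAM) FOUR-FRAME» squad F0∕P3c∕LH4 ∕ F0∕P3c∕LH7); β₂-BOARD v2 row (OFF) (lead LH7-p09 (g2); assembler LH4-p12 (g8) ED. 5 `…OffRowOfPiecesResidual`, socket `hL`, whole line);
helper lane on h413 = stmt-HodgeConjecture-24833 (count-neutral).  2026-09-05.
-/
import Summits.HodgeConjecture.HodgeConjecture.Theorems.F0P3cDyRamRayScalarNearlyFixed    -- ★ (LH4-p16 (g2)): Step A∕B lemmas `v_map_add_mul_map_le`, `v_add_map_le_of_map_le`; brings ★ p862630, ★ p861372, ★ p862581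
import Summits.HodgeConjecture.HodgeConjecture.Theorems.F0P3cDyRamLowerLineRayLetters    -- ★ p863440 (this seat): `v_rayScalar_eq_of_line`; brings ★ p863123 `isOrd_div_pow_mul_of_deep_level`
import Summits.HodgeConjecture.HodgeConjecture.Theorems.F0P3cDyRamNormFormRayOfTrace     -- ★ FILE 12 (this seat): `normFormSet_eq_ray_of_line_sizes` (the ray WITHOUT ray domination)
import Literature.NumberTheory.LocalFields.WildQuadraticDatumTraceBound                  -- ★ Lit: `trace_bound_pow_of_isRamifiedQuadraticDatum` (`|x + σx| ≤ |ϖ|^{d−1}|x|`)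
import HarnessLib

/-!
# Crux `H413`, line LH4 «(D-RAM) FOUR-FRAME» — the (β₂) road (R-36), β₂-BOARD v2 row (OFF), socket `hL`, THE WHOLE LOWER LINE: «EVERY VERTEX OF THE LOWER LINE IS A
# `σ`-FIXED-UNIT RAY» — LH4-p16 (g2)'s nearly-fixed argument (★ `…RayScalarNearlyFixed` Steps A–B) composed with ★ FILE 12's ray-by-trace letter (Step C WITHOUT ray domination):
# the band hypothesis `m* ≤ b + ℓ₀` of ★ p863533 is REPLACED by the three μ-currency sizes `g1 g2 g3` and the skew size `gsk`, all true on the lower line under the fence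

Cell `hodgecm-mathlib` (D-0151), FLOOR 0, crux item H413 = `stmt-HodgeConjecture-24833`, route of record `HCCMUnconditional`; squads F0∕P3c∕LH4 ∕ LH7; lane
`--supports stmt-HodgeConjecture-24833 --as helper` (count-neutral; pays NO tier-0 row).  THEOREMS ONLY (no `def`, no instance, no notation, no `sorry`, default heartbeats);
★-only imports; states NO law; (β₂) stays a HYPOTHESIS.  Frame = ★ p16's HEAD VERBATIM (sheet datum on `E`, block `(H₂, h)`, ★ (C1)'s line model, glued vertex), `jE` isometric.

WHY (BETA2-OFF-RESIDUAL v1 §2; ★ FILE 12).  ★ p863533 labels the RAY band `m* ≤ b + ℓ₀` of the lower line through p16's HEAD, whose Step C is ★ p861653 (ray domination).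
★ FILE 12 `normFormSet_eq_ray_of_line_sizes` gives the SAME ray letter from the sizes `g1 : |μ|·|ϖE|^{d−1} ≤ |α − ρα|·|ϖE|^b·|ϖE|^{m*}` (the cross term is a trace of an element
of `𝔭_E^j`), `g2 : |μ|·|Θα − α| ≤ …`, `g3 : |μ|·|cc| ≤ …` — true on the MIX band too (`m₀ ≥ b + d + ℓ₀`, fence).  Steps A–B of p16 (`|e₀ + σe₀| ≤ |ϖ|^n` from `Θlam·lam = 1`,
`u·σu = 1`, the population token and the skew size; Eisenstein coordinates) are cell-agnostic; the skew size is taken in μ-currency `gsk : |μ|·|μ − ρμ| ≤ |ϖE|^n·|cc(α − ρα)|·|ϖE|^b`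
(on the line: `m₀ + ℓ₀ ≥ n`, fence).  So:
* HEAD `exists_fixed_unit_valueSet_eq_smul_xPlus_of_line_sizes` — p16's frame binders VERBATIM through `hYO`, `jE` isometric, the LOWER-LINE letters `hYb hcb hμle hanti`, the
  sizes `g1 g2 g3 gsk`, `hΘlam hvlam huu he₀`, deep tokens `hlamn hun` at a level `n ≥ 3d − 2 + d%2` ⟹ p16's conclusion VERBATIM: `∃ e′` `σ`-fixed unit, `|e₀ − e′·t₊| ≤ |ϖ|^{m*}`,
  `VS_{m*}(Γ − 1 | L) = valueSetMod σ ϖ m* (e′ • X₊)` — EVERY lower-line vertex is LABELLED, by `ω(e′)`.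
HONEST LABEL.  Count-neutral composition; nothing printed is asserted; no census law is stated; the balance `hL` stays OPEN; `HC_CM` is proved only modulo the 7 printed citations
(2 remaining named inputs: hLiu418 = `stmt-HodgeConjecture-24832`, h413 = `stmt-HodgeConjecture-24833`) until rung 0 closes.
## References
* [Rogawski1990] J. D. Rogawski, *Automorphic Representations of Unitary Groups in Three Variables*, Ann. of Math. Stud. 123 (1990): §4.9 Prop. 4.9.1 (b) p. 55.
* [Jacobowitz1962] R. Jacobowitz, *Hermitian forms over local fields*, Amer. J. Math. 84 (1962): §4 (duals, gluing).
* [Kottwitz1986BaseChangeUnits] R. E. Kottwitz, *Base change for unit elements of Hecke algebras*, Compositio Math. 60 (1986): §1 pp. 240–241.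
* [Serre1979] J.-P. Serre, *Local Fields*, GTM 67 (1979): Ch. III §6 Prop. 12; Ch. V §3 Cor. 3 (norm classes of units).
-/

set_option autoImplicit false

noncomputable section

namespace Summit.HodgeConjecture.HodgeConjecture.Cruxes.H413.F0P3cDyRamLowerLineVertexRay

open scoped Valued WithZero Matrix MatrixGroups
open WithZero
open Literature.NumberTheory.Automorphic Literature.NumberTheory.Automorphic.HermitianLattice Literature.NumberTheory.Automorphic.UnitaryLatticeTree
open Literature.NumberTheory.Automorphic.UnitaryThreeFourFrame (IsRamifiedQuadraticDatum)
open Literature.NumberTheory.Rogawski1990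
open Summit.HodgeConjecture.HodgeConjecture.Cruxes.H413.F0P3cDyRamFourFramePieces
open Summit.HodgeConjecture.HodgeConjecture.Cruxes.H413.F0P3cDyRamToricCensusDefs
open Summit.HodgeConjecture.HodgeConjecture.Cruxes.H413.F0P3cDyRamBoundaryCellLetterCardTwo (v_map_lt_one_iff_of_le_iff)
open Summit.HodgeConjecture.HodgeConjecture.Cruxes.H413.F0P3cDyRamRayDominatedCellLetter (v_map_le_map_pow_of_le)
open Literature.NumberTheory.LocalFields.WildQuadraticDatum (trace_bound_pow_of_isRamifiedQuadraticDatum)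
open Summit.HodgeConjecture.HodgeConjecture.Cruxes.H413.F0P3cDyRamDepthFormLineModel (valueSet_endoGL_sub_one_glued_eq_normFormSet_of_gen)
open Summit.HodgeConjecture.HodgeConjecture.Cruxes.H413.F0P3cDyRamLabelShellFlipCardTwo (v_refSkew_eq valueSetMod_smul_xPlus_eq_of_v_sub_le_pred)
open Summit.HodgeConjecture.HodgeConjecture.Cruxes.H413.F0P3cDyRamCleanELetterRamM (exists_fixed_unit_sub_mul_refSkew_le_any)
open Summit.HodgeConjecture.HodgeConjecture.Cruxes.H413.F0P3cDyRamRayScalarNearlyFixed (v_map_add_mul_map_le v_add_map_le_of_map_le)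
open Summit.HodgeConjecture.HodgeConjecture.Cruxes.H413.F0P3cDyRamDeepConeCellOffShellLevel (isOrd_div_pow_mul_of_deep_level)
open Summit.HodgeConjecture.HodgeConjecture.Cruxes.H413.F0P3cDyRamLowerLineRayLetters (v_rayScalar_eq_of_line)
open Summit.HodgeConjecture.HodgeConjecture.Cruxes.H413.F0P3cDyRamNormFormRayOfTrace (normFormSet_eq_ray_of_line_sizes)

variable {E M : Type} [Field E] [Valued E ℤᵐ⁰] [Field M] [Valued M ℤᵐ⁰] {ρ Θ : M →+* M} {α : M}

/-- **HEAD — «EVERY VERTEX OF THE LOWER LINE IS A `σ`-FIXED-UNIT RAY».**  ★ `…RayScalarNearlyFixed`'s HEAD frame through `hYO` (without `hintρ`; + `jE` isometric), then the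
LOWER-LINE letters `hYb : |Y| = |ϖE|^b`, `hcb : |cc| < |ϖE|^b`, `hμle : |μ| ≤ |ϖE|^{2b+d%2+1}`, `hanti : |μ − ρμ| = |cc(α − ρα)|·|ϖE|^{b+d%2}`, the three RAY-BY-TRACE sizes at `m*`
(`g1 : |μ|·|ϖE|^{d−1} ≤ |α − ρα|·|ϖE|^b·|ϖE|^{m*}`, `g2 : |μ|·|Θα − α| ≤ …`, `g3 : |μ|·|cc| ≤ …`), the skew size `gsk : |μ|·|μ − ρμ| ≤ |ϖE|^n·|cc(α − ρα)|·|ϖE|^b`, the structure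
letters `hΘlam hvlam huu`, the ray scalar `he₀`, and the deep tokens `hlamn hun` at a level `n ≥ 3d − 2 + d%2`.  THEN there is a `σ`-fixed unit `e′` with `|e₀ − e′·t₊| ≤ |ϖ|^{m*}` and
`VS_{m*}(Γ − 1 | L) = valueSetMod σ ϖ m* (e′ • X₊)` — no band hypothesis.
[cite: Rogawski1990, §4.9 Prop. 4.9.1 (b) p. 55] [cite: Serre1979, Ch. III §3 Prop. 7; Ch. V §3 Cor. 3] [cite: Jacobowitz1962, §4] [cite: Kottwitz1986BaseChangeUnits, §1 pp. 240–241] -/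
theorem exists_fixed_unit_valueSet_eq_smul_xPlus_of_line_sizes {σ : E →+* E} {ϖ : E} {d t : ℕ} (hD : IsRamifiedQuadraticDatum σ ϖ d t)
    (H₂ : Matrix (Fin 2) (Fin 2) E) (h : E)
    (jE : E →+* M) (hjv : ∀ c, Valued.v (jE c) ≤ 1 ↔ Valued.v c ≤ 1) (hjiso : ∀ c, Valued.v (jE c) = Valued.v c) (hjfix : ∀ z, ρ z = z ↔ ∃ c, jE c = z)
    (hρρ : ∀ x, ρ (ρ x) = x) (hvρ : ∀ x, Valued.v (ρ x) = Valued.v x) (hα : ρ α ≠ α) (hα1 : Valued.v α ≤ 1)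
    (hΘΘ : ∀ x, Θ (Θ x) = x) (hΘρ : ∀ x, Θ (ρ x) = ρ (Θ x)) (hvΘ : ∀ x, Valued.v (Θ x) = Valued.v x) (hΘj : ∀ c, Θ (jE c) = jE (σ c))
    (φ : (Fin 2 → E) →+ M) (hφs : ∀ (c : E) (x : Fin 2 → E), φ (c • x) = jE c * φ x)
    {γ₂ : GL (Fin 2) E} {lam hM : M} (hφγ : ∀ x, φ ((γ₂ : Matrix (Fin 2) (Fin 2) E) *ᵥ x) = lam * φ x) (hhM : hM ≠ 0) (hΘh : Θ hM = hM)
    (hform : ∀ x y, jE (pairing σ H₂ x y) = hM * Θ (φ x) * φ y + ρ (hM * Θ (φ x) * φ y))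
    {L : Submodule 𝒪[E] (Fin 3 → E)} {b : ℕ} (hpr : ∀ x ∈ L, Valued.v (x 1) * Valued.v ϖ ^ b ≤ 1)
    (hint : ∀ y ∈ L, Valued.v (pairing σ (!![H₂ 0 0, 0, H₂ 0 1; 0, h, 0; H₂ 1 0, 0, H₂ 1 1] : Matrix (Fin 3) (Fin 3) E) y y) ≤ 1)
    {B₂ : Submodule 𝒪[E] (Fin 2 → E)} {w₀ : Fin 2 → E} {g₀ : Fin 3 → E}
    (hB : B₂.map ((Matrix.toLin' (!![1, 0; 0, 0; 0, 1] : Matrix (Fin 3) (Fin 2) E)).restrictScalars 𝒪[E]) =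
      L ⊓ LinearMap.ker ((LinearMap.proj (1 : Fin 3) : (Fin 3 → E) →ₗ[E] E).restrictScalars 𝒪[E]))
    (hg₀ : g₀ ∈ L) (hg₀1 : Valued.v (g₀ 1) * Valued.v ϖ ^ b = 1) (hprg : g₀ - Pi.single 1 (g₀ 1) = ![w₀ 0, 0, w₀ 1])
    (u : GL (Fin 1) E)
    {cc x₀ : M} (hc : ρ cc = cc) (hc0 : cc ≠ 0) (hc1 : Valued.v cc ≤ 1) (hcc : cc * (α - ρ α) ≠ 0) (hx₀ : x₀ ≠ 0)
    {Λ : AddSubgroup M} (hBΛ : B₂.toAddSubgroup.map φ = Λ)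
    (hΛx : ∀ x, x ∈ Λ ↔ ∃ ζ, IsOrd ρ α cc ζ ∧ x = x₀ * ζ) (hw₀Y : φ w₀ = (dualGen ρ Θ α cc hM x₀)⁻¹ * x₀)
    (hYO : IsOrd ρ α cc (dualGen ρ Θ α cc hM x₀))
    -- the LOWER-LINE letters (cell currency)
    (hYb : Valued.v (dualGen ρ Θ α cc hM x₀) = Valued.v (jE ϖ) ^ b) (hcb : Valued.v cc < Valued.v (jE ϖ) ^ b)
    (hμle : Valued.v (lam - jE ((u : Matrix (Fin 1) (Fin 1) E) 0 0)) ≤ Valued.v (jE ϖ) ^ (2 * b + d % 2 + 1))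
    (hanti : Valued.v ((lam - jE ((u : Matrix (Fin 1) (Fin 1) E) 0 0)) - ρ (lam - jE ((u : Matrix (Fin 1) (Fin 1) E) 0 0))) =
      Valued.v (cc * (α - ρ α)) * Valued.v (jE ϖ) ^ (b + d % 2))
    -- the ray-by-trace sizes at `m*` and the skew size at `n`
    (g1 : Valued.v (lam - jE ((u : Matrix (Fin 1) (Fin 1) E) 0 0)) * Valued.v (jE ϖ) ^ (d - 1) ≤
      Valued.v (α - ρ α) * Valued.v (jE ϖ) ^ b * Valued.v (jE ϖ) ^ mstarOfRecord d)
    (g2 : Valued.v (lam - jE ((u : Matrix (Fin 1) (Fin 1) E) 0 0)) * Valued.v (Θ α - α) ≤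
      Valued.v (α - ρ α) * Valued.v (jE ϖ) ^ b * Valued.v (jE ϖ) ^ mstarOfRecord d)
    (g3 : Valued.v (lam - jE ((u : Matrix (Fin 1) (Fin 1) E) 0 0)) * Valued.v cc ≤
      Valued.v (α - ρ α) * Valued.v (jE ϖ) ^ b * Valued.v (jE ϖ) ^ mstarOfRecord d)
    {n : ℕ} (hn : 3 * d - 2 + d % 2 ≤ n)
    (gsk : Valued.v (lam - jE ((u : Matrix (Fin 1) (Fin 1) E) 0 0)) * Valued.v ((lam - jE ((u : Matrix (Fin 1) (Fin 1) E) 0 0)) - ρ (lam - jE ((u : Matrix (Fin 1) (Fin 1) E) 0 0))) ≤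
      Valued.v (jE ϖ) ^ n * Valued.v (cc * (α - ρ α)) * Valued.v (jE ϖ) ^ b)
    -- the line-model structure, the ray scalar, the deep tokens
    (hΘlam : Θ lam * lam = 1) (hvlam : Valued.v lam = 1)
    (huu : ((u : Matrix (Fin 1) (Fin 1) E) 0 0) * σ ((u : Matrix (Fin 1) (Fin 1) E) 0 0) = 1)
    {e₀ : E} (he₀ : jE e₀ = (lam - jE ((u : Matrix (Fin 1) (Fin 1) E) 0 0)) / (cc * (α - ρ α) * Θ (dualGen ρ Θ α cc hM x₀)) +
      ρ ((lam - jE ((u : Matrix (Fin 1) (Fin 1) E) 0 0)) / (cc * (α - ρ α) * Θ (dualGen ρ Θ α cc hM x₀))))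
    (hlamn : Valued.v (lam - 1) ≤ Valued.v (jE ϖ) ^ n) (hun : Valued.v ((u : Matrix (Fin 1) (Fin 1) E) 0 0 - 1) ≤ Valued.v ϖ ^ n) :
    ∃ e' : E, σ e' = e' ∧ Valued.v e' = 1 ∧
      Valued.v (e₀ - e' * ((ϖ - σ ϖ) * ((ϖ * σ ϖ) ^ ((d - d % 2) / 2))⁻¹)) ≤ Valued.v ϖ ^ mstarOfRecord d ∧
      {z : E | ∃ y ∈ L, Valued.v ((ϖ ^ mstarOfRecord d)⁻¹ * (z - pairing σ (!![H₂ 0 0, 0, H₂ 0 1; 0, h, 0; H₂ 1 0, 0, H₂ 1 1] : Matrix (Fin 3) (Fin 3) E) y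
          ((((endoGL (γ₂, u) : GL (Fin 3) E) : Matrix (Fin 3) (Fin 3) E) - 1) *ᵥ y))) ≤ 1} =
        valueSetMod σ ϖ (mstarOfRecord d) (e' • xPlus σ ϖ d) := by
  obtain ⟨hσσ, hvσ, hϖ, -, hd, hd1, -⟩ := id hD
  have hm : mstarOfRecord d = d % 2 + 2 * d - 1 := rfl
  have hvϖ0 : Valued.v ϖ ≠ 0 := by rw [hϖ]; exact exp_ne_zero
  have hϖ0 : ϖ ≠ 0 := fun h0 => hvϖ0 (by rw [h0, map_zero])
  have hϖlt : Valued.v ϖ < 1 := by rw [hϖ, ← exp_zero, exp_lt_exp]; norm_num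
  have hϖ1 : Valued.v ϖ ≤ 1 := hϖlt.le
  have hjϖ0 : jE ϖ ≠ 0 := (map_ne_zero jE).2 hϖ0
  have hvjϖ0 : Valued.v (jE ϖ) ≠ 0 := (Valuation.ne_zero_iff _).2 hjϖ0
  have hvjϖpos : 0 < Valued.v (jE ϖ) := zero_lt_iff.2 hvjϖ0
  have hjϖle : Valued.v (jE ϖ) ≤ 1 := ((v_map_lt_one_iff_of_le_iff jE hjv ϖ).2 hϖlt).le
  have hρϖ : ρ (jE ϖ) = jE ϖ := (hjfix _).2 ⟨ϖ, rfl⟩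
  have hρj : ∀ c : E, ρ (jE c) = jE c := fun c => (hjfix _).2 ⟨c, rfl⟩
  set Y : M := dualGen ρ Θ α cc hM x₀ with hYdef
  set μ : M := lam - jE ((u : Matrix (Fin 1) (Fin 1) E) 0 0) with hμdef
  have hY0 : Y ≠ 0 := fun h0 => by
    rw [h0, Valuation.map_zero] at hYb
    exact pow_ne_zero b hvjϖ0 hYb.symm
  have hvYpos : 0 < Valued.v Y := zero_lt_iff.2 ((Valuation.ne_zero_iff _).2 hY0)
  -- the population token `μ∕Y ∈ 𝒪_cc` (the cell's depth clause, ★ p863123 at `L = 0`)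
  have hP : IsOrd ρ α cc (μ / Y) := by
    have h0 := isOrd_div_pow_mul_of_deep_level hvρ hα hα1 jE hjv hϖ hρϖ hYO hYb hcb.le 0
      (hμle.trans (pow_le_pow_right_of_le_one' hjϖle (by omega))) (hanti.le.trans (mul_le_mul_right (pow_le_pow_right_of_le_one' hjϖle (by omega)) _))
    rwa [pow_zero, one_mul] at h0
  -- the ray scalar on the `ℓ₀`-shell
  have he₀v : Valued.v e₀ = Valued.v ϖ ^ (d % 2) :=
    v_rayScalar_eq_of_line hρρ hvρ hα hα1 hΘρ hvΘ jE hjv hϖ hc hc0 hYO hYb hcb (d % 2) hμle hanti he₀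
  -- the skew token from `gsk`
  have hsk : Valued.v (μ / Y) * Valued.v (lam - ρ lam) ≤ Valued.v (jE ϖ) ^ n * Valued.v (cc * (α - ρ α)) := by
    have e : lam - ρ lam = μ - ρ μ := by
      rw [hμdef, map_sub, (hjfix _).2 ⟨_, rfl⟩]; ring
    rw [e, Valuation.map_div, hYb, div_mul_eq_mul_div, div_le_iff₀ (pow_pos hvjϖpos _)]
    exact gsk
  -- Step A: `|e₀ + σe₀| ≤ |ϖ|^n`
  have hpos : (0 : ℤᵐ⁰) < Valued.v (cc * (α - ρ α)) := zero_lt_iff.2 ((Valuation.ne_zero_iff _).2 hcc)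
  have hMside := v_map_add_mul_map_le σ jE hΘj hρj hρρ hvρ hΘΘ hΘρ hvΘ hc hcc hhM hΘh hx₀ hΘlam hvlam huu hP he₀
  have hMn : Valued.v (jE (e₀ + ((u : Matrix (Fin 1) (Fin 1) E) 0 0) * σ e₀)) ≤ Valued.v (jE ϖ) ^ n :=
    hMside.trans (max_le hlamn ((div_le_iff₀ hpos).2 hsk))
  have hE : Valued.v (e₀ + σ e₀) ≤ Valued.v ϖ ^ n := v_add_map_le_of_map_le hvσ jE hjv hϖ0 hMn hun (by
    rw [he₀v]; exact pow_le_one₀ zero_le hϖ1)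
  -- Step B: Eisenstein coordinates — the fixed unit `e′` at precision `(2d − 1) + d%2 = m*`
  obtain ⟨e', he'σ, he'1, hclose⟩ := exists_fixed_unit_sub_mul_refSkew_le_any hD (N := 2 * d - 1) (by omega) he₀v
    (hE.trans (pow_le_pow_right_of_le_one' hϖ1 (by omega)))
  have hclose' : Valued.v (e₀ - e' * ((ϖ - σ ϖ) * ((ϖ * σ ϖ) ^ ((d - d % 2) / 2))⁻¹)) ≤ Valued.v ϖ ^ mstarOfRecord d :=
    hclose.trans (le_of_eq (by rw [hm]; congr 1; omega))
  refine ⟨e', he'σ, he'1, hclose', ?_⟩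
  -- Step C: HEAD B, ★ FILE 12 (ray by trace), (S0″)
  have hum : Valued.v ((u : Matrix (Fin 1) (Fin 1) E) 0 0 - 1) ≤ Valued.v (ϖ ^ mstarOfRecord d) := by
    rw [Valuation.map_pow]; exact hun.trans (pow_le_pow_right_of_le_one' hϖ1 (by rw [hm]; omega))
  rw [valueSet_endoGL_sub_one_glued_eq_normFormSet_of_gen σ hϖ H₂ h jE hjv hΘΘ φ hφs hφγ hhM hform hpr hint hB hg₀ hg₀1 hprg u (mstarOfRecord d) hum hcc hx₀ hBΛ hΛx hw₀Y]
  simp_rw [mul_div_right_comm (lam - jE ((u : Matrix (Fin 1) (Fin 1) E) 0 0))]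
  rw [normFormSet_eq_ray_of_line_sizes hρρ hvρ hα hα1 hvΘ σ hσσ hvσ hϖ hd jE hjv hjiso hΘj hjfix (trace_bound_pow_of_isRamifiedQuadraticDatum hD) hc1 hcc hYO hYb
    (mstarOfRecord d) g1 g2 g3 he₀]
  -- `|e₀∕t₊ − e′| ≤ |ϖ|^{2d−1}`
  have hvt : Valued.v ((ϖ - σ ϖ) * ((ϖ * σ ϖ) ^ ((d - d % 2) / 2))⁻¹) = Valued.v ϖ ^ (d % 2) := v_refSkew_eq hvσ hϖ hd
  set tp : E := (ϖ - σ ϖ) * ((ϖ * σ ϖ) ^ ((d - d % 2) / 2))⁻¹ with htp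
  have htp0 : tp ≠ 0 := fun h0 => by rw [h0, map_zero] at hvt; exact pow_ne_zero _ hvϖ0 hvt.symm
  have hge : Valued.v (e₀ * tp⁻¹ - e') ≤ Valued.v ϖ ^ (2 * d - 1) := by
    have e : e₀ * tp⁻¹ - e' = tp⁻¹ * (e₀ - e' * tp) := by field_simp
    rw [e, Valuation.map_mul, map_inv₀, hvt, inv_mul_le_iff₀ (pow_pos (zero_lt_iff.2 hvϖ0) _), ← pow_add]
    exact hclose.trans (le_of_eq (by rw [add_comm]))
  exact valueSetMod_smul_xPlus_eq_of_v_sub_le_pred hvσ hϖ hd (show mstarOfRecord d ≤ (2 * d - 1) + d % 2 from by rw [hm]; omega) hge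

end Summit.HodgeConjecture.HodgeConjecture.Cruxes.H413.F0P3cDyRamLowerLineVertexRay

end
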